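import Summits.QuantumFields.YangMills.Theorems.UnitScaleTiltProp8FlatPortCor28PadL0
import HarnessLib

/-!
# Route `UnitScaleTilt`, crux K1 child «MinimiserStabilityRegPr» (stmt-QuantumFields-19200), v8 pillar **P2 `stub_flatOpsCubeSeq`** — THE PORT BRIDGE, file 6:
# **[Balaban1984PropagatorsII] PROPOSITION 2.7 (2.149) — THE ENTRIES OF `(QGQ*)⁻¹` — AT k LEVELS FOR EVERY TORUS FAMILY, EVERY ODD `L ≥ 5`, `k ≥ 1`, WITHOUT THE
# PLACEMENT HYPOTHESIS** (lit-balaban W1's hypothesis-free `B6QGQCoerciveKLevelV1L0.prop27_kLevel_unconditional`, binders `2 ≤ k`, `P′ ≥ 5`, `Placed`, applied to the padded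
# family `B6PadLevelV1L0.padT D` and transported back with file 4's `EE_UI` / `UI_single` / `beta_pad`) — the input `h2149` of r03's composition step `B6Cor28KLevelV1L0.comp_entry_le`,
# by which the second-order kernel rows (k3), (k4) of `H` are reached (file 7)

**LEVEL-0 TWIN** of `UnitScaleTiltProp8FlatPortProp27Pad` (GAP LIST v22 (P2-L0)): the same statements for lit-balaban's LEVEL-0-ADMITTING torus families
`B6MultiLevelTorusOperatorL0.TDomains` (blocks of every level `0 ≤ j ≤ k` — the P2 text's `Adm22` families have unit cubes `Λ₀ ≠ ∅` in general), obtained from the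
gen-17 file by the dictionary swap `B6GlobalChartV1L0.{blkV1, domT}`, `B6Geom246MultiLevel{Box,Torus}L0`, `B6Ineq2142KLevelV1L0.β`, the `…KLevelV1L0` rows of
lit-balaban's S-E port, and `UnitScaleTiltProp8FlatPort*L0`; the `D`-free lemmas of the gen-17 file are reused by name, not restated.  Seat `ym3-torus-p1` gen 18.

Cell `ym3-torus` (HUMAN RULING D-0037, YM ladder rung R3), seat `ym3-torus-p1` gen 17.  `--supports stmt-QuantumFields-19200 --as helper`; count-neutral; def-free.

WHAT IS PROVED (sorry-free; axioms standard; no definition): `lam_pad` (the conjugation weights `Λ_i` of `B6Prop27KLevelV1` do not see the padding) and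
**`prop27_kLevel_pad`** = `prop27_kLevel_unconditional` with `(2 ≤ k, P′ ≥ 5, Placed)` replaced by `(1 ≤ k, k + 1 ≤ m + K, P′ = L·P″, P″ ≥ 5)`, same constants, same conclusion
`|⟪e_i, (QGQ*)⁻¹e_{i′}⟫| ≤ Λ_i⁻¹Λ_{i′}⁻¹·(2/γ₀)·e^{−δ₄·d_T(β i, β i′)}` for the genuine `(QGQ*)⁻¹ = EE (domT hN D hk)`.
HONEST SCOPE: bookkeeping over landed certificates; inherits `M_h = Lᵃ ≥ 8`, `R ≥ 2L²`, `4 ≤ ℓ`, the band, `M₂ ≤ L·M_h`, `N₁ + 1 ≤ R·L·M_h`.  NOT a claim about the mass gap.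

References: T. Bałaban, CMP **96** (1984) 223–250 [Balaban1984PropagatorsII] Prop. 2.7 (2.147)–(2.149) p.248–249, (2.1)–(2.4) p.224.
-/

set_option autoImplicit false

noncomputable section

open scoped BigOperators InnerProductSpace

namespace Summit.QuantumFields.YangMills.Theorems.FlatPortProp27PadL0

open Literature.MathematicalPhysics.QuantumFieldTheory.Balaban1983to89
open B6MultiLevelBoxOperator (N0)
open B6MultiLevelTorusOperatorL0 (TDomains)
open B6Geom246MultiLevelTorusL0 (geomT)
open B6GlobalChartV1 (PV)
open B6GlobalChartV1L0 (domT)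
open B6Ineq2142KLevelV1L0 (β)
open B6Prop27KLevelV1L0 (lam)
open B6SectAOperatorsV1 (BondIdx)
open B6SectAVectorModelV1 (EE)
open B6RandomWalk (delta3)
open B6QGQCoerciveKLevelV1 (gam0)
open B6QGQCoerciveKLevelV1L0 (prop27_kLevel_unconditional)
open B6CubeWindowV1 (GlobalBand)
open B6PadLevelV1 (hN_pad)
open B6PadLevelV1L0 (padT placed_pad sameOm_domT_pad dist_eT globalBand_pad)
open FlatPortCor28Pad (UI_single EE_UI)
open FlatPortCor28PadL0 (beta_pad)

variable {d ℓ m K : ℕ} {hd : 1 ≤ d + 1} {hL : Odd (ℓ + 1) ∧ 1 < ℓ + 1}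
variable {Mh k R : ℕ} {P' P'' : Fin (d + 1) → ℕ}

/-- the conjugation weight `Λ_i` depends only on the level of the index bond: unchanged under padding. [cite: Balaban1984PropagatorsII, (2.81) p.237, bookkeeping] -/
theorem lam_pad (hN : ∀ μ, N0 ℓ Mh k P' μ = (PV d ℓ m K hd hL).sitesPerDir 0) (D : TDomains d ℓ Mh k P' R) (hk : k ≤ m + K)
    (hLP : ∀ μ, P' μ = (ℓ + 1) * P'' μ) (hk' : k + 1 ≤ m + K) (cf : ℝ) (cI : BondIdx (B6GlobalChartV1L0.domT hN D hk)) :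
    lam (hN_pad hN hLP) (padT D hLP) hk' cf ((sameOm_domT_pad hN D hk hLP hk').idxB.symm cI) = lam hN D hk cf cI := rfl

/-- **[B6] PROPOSITION 2.7 (2.149) AT k LEVELS, EVERY ODD `L ≥ 5`, `k ≥ 1`, NO PLACEMENT HYPOTHESIS**: the binders of `B6QGQCoerciveKLevelV1L0.prop27_kLevel_unconditional` with
`(2 ≤ k, P′ ≥ 5, Placed)` replaced by `(1 ≤ k, k + 1 ≤ m + K, P′ = L·P″, P″ ≥ 5)`; same constants `σ₁, A′, M₂, c, N₁`, same entry bound for `(QGQ*)⁻¹` of `domT hN D hk`.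
[cite: Balaban1984PropagatorsII, Prop. 2.7 (2.147)–(2.149) p.248–249, (2.1)–(2.4) p.224] -/
theorem prop27_kLevel_pad (d ℓ : ℕ) (hd : 1 ≤ d + 1) (hL : Odd (ℓ + 1) ∧ 1 < ℓ + 1) {b₀ b₁ : ℝ} (hb₀ : 0 < b₀) (hb₁ : b₀ ≤ b₁) :
    ∃ σ₁ : ℝ, 0 < σ₁ ∧ ∀ (σ : ℝ), 0 < σ → σ ≤ σ₁ → ∀ (α : ℝ), 0 < α → α < 1 →
    ∃ (A' M₂ c : ℝ) (N₁ : ℕ), 0 < A' ∧ 0 < M₂ ∧ 0 ≤ c ∧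
    ∀ (m K : ℕ) {Mh k R : ℕ} {P' : Fin (d + 1) → ℕ}
      (hN : ∀ μ, N0 ℓ Mh k P' μ = (PV d ℓ m K hd hL).sitesPerDir 0) (D : TDomains d ℓ Mh k P' R) (hk : k ≤ m + K) (_ : 1 ≤ k) (_ : k + 1 ≤ m + K)
      {P'' : Fin (d + 1) → ℕ} (_ : ∀ μ, P' μ = (ℓ + 1) * P'' μ) (_ : ∀ μ, 5 ≤ P'' μ)
      {a : ℕ} (_ : Mh = (ℓ + 1) ^ a) (_ : 8 ≤ Mh) (_ : 2 * (ℓ + 1) ^ 2 ≤ R) (_ : 4 ≤ ℓ)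
      (_ : M₂ ≤ ((ℓ : ℝ) + 1) * Mh) (_ : N₁ + 1 ≤ R * ((ℓ + 1) * Mh))
      {cf : ℝ} (hcf : cf ≠ 0) {w : BondIdx (B6GlobalChartV1L0.domT hN D hk) → ℝ} (hw : ∀ i, 0 < w i) (_ : GlobalBand b₀ b₁ cf w),
      ∀ i i' : BondIdx (domT hN D hk),
        |⟪EuclideanSpace.single i (1 : ℝ), EE (domT hN D hk) hcf hw (EuclideanSpace.single i' (1 : ℝ))⟫_ℝ| ≤
          (lam hN D hk cf i)⁻¹ * (lam hN D hk cf i')⁻¹ * (2 / gam0 d ℓ b₁ *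
            Real.exp (-(min (delta3 α (2 * σ) / 4) (gam0 d ℓ b₁ / A' / (2 * (1 * (4 / delta3 α (2 * σ)) * (2 * ((d : ℝ) + 1) * c)) + 1)) *
              (geomT D).dist (β hN D hk i) (β hN D hk i')))) := by
  obtain ⟨σ₁, hσ₁, h⟩ := prop27_kLevel_unconditional d ℓ hd hL hb₀ hb₁
  refine ⟨σ₁, hσ₁, fun σ hσ hσ1 α hα hα1 => ?_⟩
  obtain ⟨A', M₂, c, N₁, hA', hM₂, hc, hmain⟩ := h σ hσ hσ1 α hα hα1
  refine ⟨A', M₂, c, N₁, hA', hM₂, hc, ?_⟩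
  intro m K Mh k R P' hN D hk _hk1 hk' P'' hLP hP5 a hMha hM8 hR2 hℓ hM hRM cf hcf w hw hwb i i'
  have hS := sameOm_domT_pad hN D hk hLP hk'
  have hw' : ∀ j, 0 < (w ∘ hS.idxB) j := fun j => hw _
  have key := hmain m K (hN_pad hN hLP) (padT D hLP) hk' (by omega) hMha hM8 hR2 hP5 hℓ (placed_pad D hLP hP5) hM hRM hcf hw'
    (globalBand_pad D hLP hN hk hk' hwb) (hS.idxB.symm i) (hS.idxB.symm i')
  rw [UI_single hS i, UI_single hS i', EE_UI hS hcf hw hw', hS.UI.inner_map_map, lam_pad hN D hk hLP hk' cf i, lam_pad hN D hk hLP hk' cf i',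
    beta_pad hN D hk hLP hk' i, beta_pad hN D hk hLP hk' i', dist_eT] at key
  exact key

end Summit.QuantumFields.YangMills.Theorems.FlatPortProp27PadL0

end
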